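import Mathlib.Combinatorics.SimpleGraph.Coloring.Vertex
import Mathlib.Algebra.Field.MinimalAxioms
import Mathlib.FieldTheory.Finite.GaloisField
import Mathlib.Tactic.DeriveFintype
import Mathlib.Tactic.LinearCombination
import Summits.Ventures.DiscreteObjects.UnitDistance.UnitCircleGraph
import HarnessLib

/-!
# Three colours mod `3` at an INERT prime: `χ(UD(F₉²)) = 3`, and 3-integral unit-distance graphs over `ℚ(√d)`, `d ≡ 2 (mod 3)`
(cell `pub-namedobj`, target (U), seat udg g15)

Framing (verbatim for the cell): lottery ticket; floor = certified bounds/negative ranges.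

The (U) residue-field atlas (`AtlasResidueFieldsKernel`) lists the fields `F_q`, `q ≡ 3 (mod 4)`, met by Madore's reduction; for a square-free
`d ≡ 2 (mod 3)` the prime `3` is INERT in `ℚ(√d)` (residue field `F₉`, where `−1` is a square), unit vectors need not be `3`-integral, and the
reduction says nothing about `χ(ℚ(√d)²)` — this is exactly the class of `d ≡ 3 (mod 4)` whose quadratic planes are NOT `3`-coloured by the
3-adic criterion and where every decided row of the census has `χ = 4` (`11, 23, 35, 59, 71, 95, 119, 131, 179, 191`; open below `100`: `83`).
This file records the complementary elementary fact and its consequence for witness hunting: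

* `F9` — the field with nine elements as `a + b·i` over `ZMod 3`, `i² = −1` (computable model, `Field.ofMinimalAxioms`);
* `chromaticNumber_unitCircleGraph_of_card_eq_nine` — `χ(unitCircleGraph F) = 3` for EVERY field with `9` elements: the unit circle of `F₉²`
  has the `8` points `(±1,0), (0,±1), (±i,±i)`, the `F₃`-linear functional `(x, y) ↦ Re x + Im x + Re y` vanishes on none of them (a proper
  3-colouring), and `(0,0), (1,0), (2,0)` is a triangle (characteristic `3`);
* `colorable_three_of_intCoords_not_three_dvd` — the census form: a finite graph whose vertices carry integer coordinates `(A, B, C, E)`, read as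
  the point `((A + B√d)/D, (C + E√d)/D)`, adjacent vertices differing by exact unit steps (`ΔA² + d·ΔB² + ΔC² + d·ΔE² = D²`, `ΔA·ΔB + ΔC·ΔE = 0` —
  the `unitStep` test of every `PlaneSqrt<d>WitnessData` file), is `3`-COLOURABLE whenever `d ≡ 2 (mod 3)` and `3 ∤ D`
  (reduce `(A + B i)·D, (C + E i)·D` into `F₉²`; `D² ≡ 1`).

CONSEQUENCE (structural, for the search): for `d ≡ 2 (mod 3)` every non-3-colourable unit-distance graph in `ℚ(√d)²` uses a unit vector with a `3`
in its denominator — all landed witnesses do (`W₁₁ /30, W₂₃, W₃₅, W₅₉ /510, W₇₁, W₉₅ /120, W₁₁₉ /60, W₁₃₁ /390, W₁₄₃ /60, W₁₇₉ /390, W₁₉₁ /60`), and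
generator families with all denominators prime to `3` (udg g14's negatives `{5, 13, 65, 130}` for `d = 251`, `{5, 53, 106, 265}` for `d = 203`)
can never contain one, at any radius.  Nothing here is literature (elementary; formalisation ours).
-/

namespace Summit.Ventures.DiscreteObjects.UnitDistance

open SimpleGraph

/-- Explicit model of the field with nine elements: `⟨a, b⟩` stands for `a + b·i` with `i² = −1` (`F₃[i]`, `X² + 1` irreducible mod `3`). -/
@[ext]
structure F9 where
  /-- real part (coefficient of `1`) -/
  a : ZMod 3
  /-- imaginary part (coefficient of `i`) -/
  b : ZMod 3
deriving DecidableEq, Repr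

namespace F9

/-- Enumeration of the carrier through `ZMod 3 × ZMod 3` (kernel-reducible). -/
instance : Fintype F9 :=
  Fintype.ofEquiv (ZMod 3 × ZMod 3) ⟨fun p => ⟨p.1, p.2⟩, fun x => (x.a, x.b), fun _ => rfl, fun _ => rfl⟩

/-- Addition (componentwise). -/
protected def add (x y : F9) : F9 := ⟨x.a + y.a, x.b + y.b⟩
/-- Negation (componentwise). -/
protected def neg (x : F9) : F9 := ⟨-x.a, -x.b⟩
/-- Multiplication: `(a + bi)(a' + b'i) = (aa' − bb') + (ab' + ba')i`. -/
protected def mul (x y : F9) : F9 := ⟨x.a * y.a - x.b * y.b, x.a * y.b + x.b * y.a⟩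

/-- `0 = 0 + 0·i`. -/
instance : Zero F9 := ⟨⟨0, 0⟩⟩
/-- `1 = 1 + 0·i`. -/
instance : One F9 := ⟨⟨1, 0⟩⟩
/-- `+` is `F9.add`. -/
instance : Add F9 := ⟨F9.add⟩
/-- `-` is `F9.neg`. -/
instance : Neg F9 := ⟨F9.neg⟩
/-- `*` is `F9.mul`. -/
instance : Mul F9 := ⟨F9.mul⟩

/-- Iterated product `x ↦ xⁿ` by structural recursion (used only to define the inverse). -/
def pw : ℕ → F9 → F9
  | 0, _ => 1
  | n + 1, x => x * pw n x

/-- Inverse `x⁻¹ := x⁷` (the multiplicative group has order `8`; `0⁷ = 0`). -/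
instance : Inv F9 := ⟨fun x => pw 7 x⟩

/-- Unfolding lemma for `+`. -/
theorem add_def (x y : F9) : x + y = ⟨x.a + y.a, x.b + y.b⟩ := rfl
/-- Unfolding lemma for `-`. -/
theorem neg_def (x : F9) : -x = ⟨-x.a, -x.b⟩ := rfl
/-- Unfolding lemma for `*`. -/
theorem mul_def (x y : F9) : x * y = ⟨x.a * y.a - x.b * y.b, x.a * y.b + x.b * y.a⟩ := rfl
/-- Unfolding lemma for `0`. -/
theorem zero_def : (0 : F9) = ⟨0, 0⟩ := rfl
/-- Unfolding lemma for `1`. -/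
theorem one_def : (1 : F9) = ⟨1, 0⟩ := rfl

/-- Associativity of `+` (componentwise). -/
theorem add_assoc' (x y z : F9) : x + y + z = x + (y + z) := by
  ext <;> simp only [add_def] <;> ring
/-- `0 + x = x`. -/
theorem zero_add' (x : F9) : 0 + x = x := by
  ext <;> simp only [add_def, zero_def] <;> ring
/-- `-x + x = 0`. -/
theorem neg_add_cancel' (x : F9) : -x + x = 0 := by
  ext <;> simp only [add_def, neg_def, zero_def] <;> ring
/-- Associativity of `*` (a polynomial identity over `ZMod 3`). -/
theorem mul_assoc' (x y z : F9) : x * y * z = x * (y * z) := by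
  ext <;> simp only [mul_def] <;> ring
/-- Commutativity of `*`. -/
theorem mul_comm' (x y : F9) : x * y = y * x := by
  ext <;> simp only [mul_def] <;> ring
/-- `1 * x = x`. -/
theorem one_mul' (x : F9) : 1 * x = x := by
  ext <;> simp only [mul_def, one_def] <;> ring
/-- Left distributivity. -/
theorem left_distrib' (x y z : F9) : x * (y + z) = x * y + x * z := by
  ext <;> simp only [mul_def, add_def] <;> ring
/-- KERNEL FACT: `x · x⁷ = 1` for the eight non-zero elements. -/
theorem mul_inv_cancel' : ∀ x : F9, x ≠ 0 → x * x⁻¹ = 1 := by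
  decide +kernel
/-- `0⁻¹ = 0⁷ = 0`. -/
theorem inv_zero' : (0 : F9)⁻¹ = 0 := by
  decide +kernel

/-- The operations above make `F9` a field. -/
instance instField : Field F9 :=
  Field.ofMinimalAxioms F9 add_assoc' zero_add' neg_add_cancel' mul_assoc' mul_comm' one_mul'
    mul_inv_cancel' inv_zero' left_distrib' ⟨0, 1, by decide⟩

/-- `F9` has nine elements. -/
theorem card_eq : Fintype.card F9 = 9 := by
  decide +kernel

/-- `i = ⟨0, 1⟩` squares to `−1`, and `−1` is not a square in `ZMod 3` — so the model is `F₃[X]/(X² + 1)` (recorded for the reader). -/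
theorem i_sq : (⟨0, 1⟩ : F9) * ⟨0, 1⟩ = -1 ∧ ∀ z : ZMod 3, z * z ≠ -1 :=
  ⟨by decide +kernel, by decide⟩

end F9

open F9

/-- The linear colouring of `F₉²`: `(x, y) ↦ Re x + Im x + Re y ∈ ZMod 3`. -/
def udF9Colour (v : F9 × F9) : ZMod 3 := v.1.a + v.1.b + v.2.a

/-- The eight points of the unit circle `x² + y² = 1` in `F₉²`: `(±1, 0), (0, ±1), (±i, ±i)`. -/
def udF9Circle : List (F9 × F9) :=
  [(⟨1, 0⟩, ⟨0, 0⟩), (⟨2, 0⟩, ⟨0, 0⟩), (⟨0, 0⟩, ⟨1, 0⟩), (⟨0, 0⟩, ⟨2, 0⟩),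
   (⟨0, 1⟩, ⟨0, 1⟩), (⟨0, 1⟩, ⟨0, 2⟩), (⟨0, 2⟩, ⟨0, 1⟩), (⟨0, 2⟩, ⟨0, 2⟩)]

/-- KERNEL FACT: every solution of `x² + y² = 1` in `F₉²` is one of the eight listed points (`81` cases). -/
theorem mem_udF9Circle : ∀ s : F9 × F9, s.1 ^ 2 + s.2 ^ 2 = 1 → s ∈ udF9Circle := by
  decide +kernel

/-- The colouring is additive: `c(x + s) = c(x) + c(s)`. -/
theorem udF9Colour_add (x s : F9 × F9) : udF9Colour (x + s) = udF9Colour x + udF9Colour s := by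
  simp only [udF9Colour, Prod.fst_add, Prod.snd_add, add_def]
  ring

/-- KERNEL FACT: the functional vanishes on no circle point. -/
theorem udF9Colour_circle_ne_zero : ∀ s ∈ udF9Circle, udF9Colour s ≠ 0 := by
  decide

/-- The linear colouring is a proper 3-colouring of `unitCircleGraph F9`. -/
theorem udF9Colour_proper (x y : F9 × F9) (h : (unitCircleGraph F9).Adj x y) : udF9Colour x ≠ udF9Colour y := by
  obtain ⟨_, h⟩ := h
  have hs : (y - x).1 ^ 2 + (y - x).2 ^ 2 = 1 := by
    have e1 : (y - x).1 ^ 2 = (x.1 - y.1) ^ 2 := by simp only [Prod.fst_sub]; ring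
    have e2 : (y - x).2 ^ 2 = (x.2 - y.2) ^ 2 := by simp only [Prod.snd_sub]; ring
    rw [e1, e2]; exact h
  have hne := udF9Colour_circle_ne_zero (y - x) (mem_udF9Circle _ hs)
  intro hxy
  apply hne
  have key := udF9Colour_add x (y - x)
  rw [add_sub_cancel] at key
  -- `c y = c x + c (y - x)` and `c x = c y`
  have : udF9Colour x + udF9Colour (y - x) = udF9Colour x + 0 := by rw [← key, ← hxy, add_zero]
  exact add_left_cancel this

/-- The linear colouring as a `ZMod 3`-colouring of `unitCircleGraph F9`. -/
def udF9Coloring : (unitCircleGraph F9).Coloring (ZMod 3) :=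
  Coloring.mk udF9Colour (fun {x y} h => udF9Colour_proper x y h)

/-- `unitCircleGraph F9` is `3`-colourable (explicit linear colouring). -/
theorem unitCircleGraph_F9_colorable_three : (unitCircleGraph F9).Colorable 3 := by
  simpa [ZMod.card] using udF9Coloring.colorable

/-- TRANSFER: every field with nine elements has a `3`-colourable unit-circle graph. -/
theorem unitCircleGraph_colorable_three_of_card_eq_nine (F : Type*) [Field F] [Fintype F] (hF : Fintype.card F = 9) :
    (unitCircleGraph F).Colorable 3 := by
  have e : F ≃+* F9 := FiniteField.ringEquivOfCardEq (by rw [hF, F9.card_eq])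
  exact unitCircleGraph_colorable_of_ringHom e.toRingHom unitCircleGraph_F9_colorable_three

/-- In characteristic `3` the points `(0,0), (1,0), (2,0)` form a TRIANGLE of the unit-circle graph (`(0 − 2)² = 4 = 1`): no `2`-colouring. -/
theorem not_colorable_two_unitCircleGraph_of_three_eq_zero (A : Type*) [CommRing A] [Nontrivial A] (h3 : (3 : A) = 0) :
    ¬ (unitCircleGraph A).Colorable 2 := by
  rintro ⟨C⟩
  have key : ∀ a b c : Fin 2, a ≠ b → a ≠ c → b ≠ c → False := by decide
  have u01 : ((0 : A) - 1) ^ 2 + ((0 : A) - 0) ^ 2 = 1 := by ring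
  have u02 : ((0 : A) - 2) ^ 2 + ((0 : A) - 0) ^ 2 = 1 := by linear_combination (1 : A) * h3
  have u12 : ((1 : A) - 2) ^ 2 + ((0 : A) - 0) ^ 2 = 1 := by ring
  have h01 : (unitCircleGraph A).Adj ((0 : A), (0 : A)) (1, 0) := ⟨ne_of_sq_add_sq_eq_one u01, u01⟩
  have h02 : (unitCircleGraph A).Adj ((0 : A), (0 : A)) (2, 0) := ⟨ne_of_sq_add_sq_eq_one u02, u02⟩
  have h12 : (unitCircleGraph A).Adj ((1 : A), (0 : A)) (2, 0) := ⟨ne_of_sq_add_sq_eq_one u12, u12⟩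
  exact key _ _ _ (C.valid h01) (C.valid h02) (C.valid h12)

/-- A field with nine elements has characteristic `3`: `(3 : F) = 0`. -/
theorem three_eq_zero_of_card_eq_nine (F : Type*) [Field F] [Fintype F] (hF : Fintype.card F = 9) : (3 : F) = 0 := by
  have e : F ≃+* F9 := FiniteField.ringEquivOfCardEq (by rw [hF, F9.card_eq])
  have h9 : (3 : F9) = 0 := by decide +kernel
  have : e 3 = e 0 := by rw [map_ofNat, map_zero, h9]
  exact e.injective this

/-- `χ(unitCircleGraph F) = 3` for EVERY field `F` with nine elements. -/
theorem chromaticNumber_unitCircleGraph_of_card_eq_nine (F : Type*) [Field F] [Fintype F] (hF : Fintype.card F = 9) :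
    (unitCircleGraph F).chromaticNumber = 3 :=
  chromaticNumber_eq_iff_colorable_not_colorable.mpr
    ⟨unitCircleGraph_colorable_three_of_card_eq_nine F hF,
     not_colorable_two_unitCircleGraph_of_three_eq_zero F (three_eq_zero_of_card_eq_nine F hF)⟩

/-! ## The census form: integer coordinates at a denominator prime to `3` -/

namespace F9

/-- Unfolding lemma for `-` (binary). -/
theorem sub_def (x y : F9) : x - y = ⟨x.a - y.a, x.b - y.b⟩ := by
  rw [sub_eq_add_neg]; ext <;> simp only [add_def, neg_def] <;> ring

end F9

/-- Reduction of an integer quadruple `(A, B, C, E)` at denominator `D` into `F₉²`: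
`((Ā + B̄ i)·D̄, (C̄ + Ē i)·D̄)` — for `3 ∤ D` one has `D̄² = 1`, so multiplying by `D̄` is dividing by it. -/
def redF9 (D : ℤ) (q : ℤ × ℤ × ℤ × ℤ) : F9 × F9 :=
  (⟨(q.1 : ZMod 3) * (D : ZMod 3), (q.2.1 : ZMod 3) * (D : ZMod 3)⟩,
   ⟨(q.2.2.1 : ZMod 3) * (D : ZMod 3), (q.2.2.2 : ZMod 3) * (D : ZMod 3)⟩)

/-- KEY COMPUTATION: an exact unit step `ΔA² + d ΔB² + ΔC² + d ΔE² = D²`, `ΔA ΔB + ΔC ΔE = 0` between two integer quadruples reduces,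
for `d ≡ 2 (mod 3)` and `3 ∤ D`, to a unit step of `F₉²`. -/
theorem redF9_unitStep {d D : ℤ} (hd : d % 3 = 2) (hD : ¬ (3 : ℤ) ∣ D) (p q : ℤ × ℤ × ℤ × ℤ)
    (h1 : (p.1 - q.1) ^ 2 + d * (p.2.1 - q.2.1) ^ 2 + (p.2.2.1 - q.2.2.1) ^ 2 + d * (p.2.2.2 - q.2.2.2) ^ 2 = D ^ 2)
    (h2 : (p.1 - q.1) * (p.2.1 - q.2.1) + (p.2.2.1 - q.2.2.1) * (p.2.2.2 - q.2.2.2) = 0) :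
    ((redF9 D p).1 - (redF9 D q).1) ^ 2 + ((redF9 D p).2 - (redF9 D q).2) ^ 2 = 1 := by
  have hd' : (d : ZMod 3) = -1 := by
    have h3 : d % ((3 : ℕ) : ℤ) = 2 := by simpa using hd
    rw [← ZMod.intCast_mod d 3, h3]; decide
  have hD' : (D : ZMod 3) ^ 2 = 1 := by
    have hne : (D : ZMod 3) ≠ 0 := by rwa [Ne, ZMod.intCast_zmod_eq_zero_iff_dvd]
    have key : ∀ z : ZMod 3, z ≠ 0 → z ^ 2 = 1 := by decide
    exact key _ hne
  have h1' := congrArg (Int.cast : ℤ → ZMod 3) h1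
  have h2' := congrArg (Int.cast : ℤ → ZMod 3) h2
  push_cast at h1' h2'
  rw [hd'] at h1'
  simp only [redF9, F9.sub_def, sq, F9.mul_def, F9.add_def, F9.one_def, F9.mk.injEq]
  constructor
  · linear_combination (D : ZMod 3) ^ 2 * h1' + ((D : ZMod 3) ^ 2 + 1) * hD'
  · linear_combination 2 * (D : ZMod 3) ^ 2 * h2'

/-- CENSUS FORM.  Let the vertices of a graph carry integer coordinates `c v = (A, B, C, E)`, read as the point `((A + B√d)/D, (C + E√d)/D)`
of `ℚ(√d)²`, such that adjacent vertices differ by an exact unit step (the `unitStep` test of the cell's witness files).  If `d ≡ 2 (mod 3)`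
and `3 ∤ D`, the graph is `3`-colourable: reduction into `F₉²` is a graph homomorphism into `unitCircleGraph F9`, which is `3`-colourable.
Contrapositive: every `4`-chromatic unit-distance graph of `ℚ(√d)²`, `d ≡ 2 (mod 3)`, has a `3` in the common denominator of its coordinates. -/
theorem colorable_three_of_intCoords_not_three_dvd {V : Type*} {G : SimpleGraph V} {d D : ℤ} (hd : d % 3 = 2) (hD : ¬ (3 : ℤ) ∣ D)
    (c : V → ℤ × ℤ × ℤ × ℤ)
    (hadj : ∀ ⦃v w : V⦄, G.Adj v w →
      ((c v).1 - (c w).1) ^ 2 + d * ((c v).2.1 - (c w).2.1) ^ 2 + ((c v).2.2.1 - (c w).2.2.1) ^ 2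
          + d * ((c v).2.2.2 - (c w).2.2.2) ^ 2 = D ^ 2 ∧
        ((c v).1 - (c w).1) * ((c v).2.1 - (c w).2.1) + ((c v).2.2.1 - (c w).2.2.1) * ((c v).2.2.2 - (c w).2.2.2) = 0) :
    G.Colorable 3 := by
  let f : G →g unitCircleGraph F9 :=
    { toFun := fun v => redF9 D (c v)
      map_rel' := by
        intro v w hvw
        have h := redF9_unitStep hd hD (c v) (c w) (hadj hvw).1 (hadj hvw).2
        exact ⟨ne_of_sq_add_sq_eq_one h, h⟩ }
  exact unitCircleGraph_F9_colorable_three.of_hom f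

/-- The same with the unit test written on the difference quadruple `(ΔA, ΔB, ΔC, ΔE)` as the data files do
(`ΔA² + d ΔB² + ΔC² + d ΔE² = D²`, `ΔA ΔB + ΔC ΔE = 0`), for natural `d` and `D`. -/
theorem colorable_three_of_natCoords_not_three_dvd {V : Type*} {G : SimpleGraph V} {d D : ℕ} (hd : d % 3 = 2) (hD : ¬ 3 ∣ D)
    (c : V → ℤ × ℤ × ℤ × ℤ)
    (hadj : ∀ ⦃v w : V⦄, G.Adj v w →
      ((c v).1 - (c w).1) ^ 2 + (d : ℤ) * ((c v).2.1 - (c w).2.1) ^ 2 + ((c v).2.2.1 - (c w).2.2.1) ^ 2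
          + (d : ℤ) * ((c v).2.2.2 - (c w).2.2.2) ^ 2 = (D : ℤ) ^ 2 ∧
        ((c v).1 - (c w).1) * ((c v).2.1 - (c w).2.1) + ((c v).2.2.1 - (c w).2.2.1) * ((c v).2.2.2 - (c w).2.2.2) = 0) :
    G.Colorable 3 :=
  colorable_three_of_intCoords_not_three_dvd (d := (d : ℤ)) (D := (D : ℤ)) (by exact_mod_cast hd) (by exact_mod_cast hD) c hadj

/-- SUMMARY (one statement): for every field `F` with nine elements `χ(unitCircleGraph F) = 3`; and unit-distance graphs of
`ℚ(√d)²`, `d ≡ 2 (mod 3)`, given by integer coordinates over a denominator prime to `3` are `3`-colourable. -/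
theorem three_integral_summary :
    (∀ (F : Type) [Field F] [Fintype F], Fintype.card F = 9 → (unitCircleGraph F).chromaticNumber = 3) ∧
    (∀ (d D : ℕ), d % 3 = 2 → ¬ 3 ∣ D → ∀ (n : ℕ) (G : SimpleGraph (Fin n)) (c : Fin n → ℤ × ℤ × ℤ × ℤ),
      (∀ ⦃v w : Fin n⦄, G.Adj v w →
        ((c v).1 - (c w).1) ^ 2 + (d : ℤ) * ((c v).2.1 - (c w).2.1) ^ 2 + ((c v).2.2.1 - (c w).2.2.1) ^ 2
            + (d : ℤ) * ((c v).2.2.2 - (c w).2.2.2) ^ 2 = (D : ℤ) ^ 2 ∧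
          ((c v).1 - (c w).1) * ((c v).2.1 - (c w).2.1) + ((c v).2.2.1 - (c w).2.2.1) * ((c v).2.2.2 - (c w).2.2.2) = 0) →
      G.Colorable 3) :=
  ⟨fun F _ _ hF => chromaticNumber_unitCircleGraph_of_card_eq_nine F hF,
   fun _ _ hd hD _ _ c hadj => colorable_three_of_natCoords_not_three_dvd hd hD c hadj⟩

end Summit.Ventures.DiscreteObjects.UnitDistance
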